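import Mathlib
import HarnessLib

/-!
# CatalanRayAtoms — odd-prime valuation bounds for the universal harmonic atoms `σ(a)`, `gsum(c)`, `W(a)` of the Catalan-box pole expansions

HONEST FRAMING: systematic search; no irrationality claim unless certified.

fam-denom (pub-zeta5), service for fam-catalan.  In the pole expansions of the Catalan-box linear forms
`J(h,j,k,l,m) = Q·G + P` (`families/denom/CATK1.md` Lemma S, `CATK6.md` §1) the rational part `P` is a finite sum of
(pole coefficient) × (harmonic ATOM); three of the four atoms are universal finite sums (depending on the pole only)
* `σ(a)   = Σ_{i<a} C(2i,i) / (4^i (2i+1))`            (from `S₁(a) = Σ_ν t_ν/(ν+½+a) = 2 t_{a−1} σ(a)`, `a ≥ 1`),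
* `gsum(c) = Σ_{μ<c} 4^μ / (2 (2μ+1)² C(2μ,μ))`        (from `S₁(−c) = 8 C(2c,c) 4^{−c} (G − gsum(c))`, `c ≥ 1`),
* `W(a)   = 8 + Σ_{1≤b<a} (8C(2b,b)/(4^b(2b+1)²) − 2σ(b)/(b(2b+1)))`  (from `S₂(a) = t_{a−1}(W(a) − 8G)`, CATK1 (S-iv)),
the fourth (`Λ_a`, a logarithmic derivative of the integrand's rational function) depends on the representation.
This file proves the three ATOM LEMMAS of `CATK6.md` §3 / `CATK1.md` L5–L7 used (with cost 1, 2, 2 per prime-power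
level `q ≤ 2a−1`, `q ≤ 2c−1`) in the proof of Theorem K6:  for every ODD prime `p`,
* `sigmaAtom_padicValRat_ge :  −⌊log_p(2a−1)⌋ ≤ v_p(σ(a))`,
* `gsumAtom_padicValRat_ge  :  −2⌊log_p(2c−1)⌋ ≤ v_p(gsum(c))`,
* `Watom_padicValRat_ge     :  −2⌊log_p(2a−1)⌋ ≤ v_p(W(a))`   (via `coprime_budget`: `gcd(b,2b+1) = 1`),
the second via the Kummer-type inequality `choose_central_odd_sq : 2·v_p(2μ+1) + v_p(C(2μ,μ)) ≤ 2⌊log_p(2μ+1)⌋`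
(if `p ∣ 2μ+1` then `p ∤ μ+1` and `(2μ+1)C(2μ,μ) = (μ+1)C(2μ+1,μ)`, so `v_p((2μ+1)C(2μ,μ)) = v_p(C(2μ+1,μ)) ≤ ⌊log_p(2μ+1)⌋`
by Legendre/Kummer (`Nat.factorization_choose_le_log`); otherwise `v_p(2μ+1) = 0`).  Together with the generic ultrametric
lemma `le_padicValRat_sum`.  Companion of the staged `Denom/CatalanRayDigits.lean` (digit inequalities, Legendre
transcriptions, per-term allowances); the atom `Λ_a` and the pole coefficients are left to the file that defines the
explicit rational part (FAMILY.md §6 D9).  Imports: Mathlib + HarnessLib only (independent of `CatalanRayDigits`).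
-/

namespace Summit.KontsevichZagierPeriods.Zeta5Search.Denom.CatalanRayAtoms

open Finset

/-- `σ(a) = Σ_{i<a} C(2i,i)/(4^i (2i+1))`. -/
def sigmaAtom (a : ℕ) : ℚ :=
  ∑ i ∈ range a, (Nat.choose (2 * i) i : ℚ) / ((4 ^ i * (2 * i + 1) : ℕ) : ℚ)

/-- `gsum(c) = Σ_{μ<c} 4^μ/(2 (2μ+1)² C(2μ,μ))`. -/
def gsumAtom (c : ℕ) : ℚ :=
  ∑ μ ∈ range c, ((4 ^ μ : ℕ) : ℚ) / ((2 * (2 * μ + 1) ^ 2 * Nat.choose (2 * μ) μ : ℕ) : ℚ)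

/-- Sanity values: `σ(0) = 0`, `σ(1) = 1`, `σ(2) = 7/6`, `σ(3) = 149/120`. -/
theorem sigmaAtom_small : sigmaAtom 0 = 0 ∧ sigmaAtom 1 = 1 ∧ sigmaAtom 2 = 7 / 6 ∧ sigmaAtom 3 = 149 / 120 := by
  refine ⟨?_, ?_, ?_, ?_⟩ <;> norm_num [sigmaAtom, Finset.sum_range_succ, Nat.choose_succ_succ]

/-- Sanity values: `gsum(0) = 0`, `gsum(1) = 1/2`, `gsum(2) = 11/18`. -/
theorem gsumAtom_small : gsumAtom 0 = 0 ∧ gsumAtom 1 = 1 / 2 ∧ gsumAtom 2 = 11 / 18 := by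
  refine ⟨?_, ?_, ?_⟩ <;> norm_num [gsumAtom, Finset.sum_range_succ, Nat.choose_succ_succ]

/-! ### Generic lemmas -/

/-- Ultrametric lower bound for a finite sum when the common bound is `≤ 0`
(a vanishing partial sum has valuation `0 ≥ k` by convention, so no non-vanishing hypothesis is needed). -/
theorem le_padicValRat_sum {p : ℕ} [Fact p.Prime] {ι : Type*} (s : Finset ι) (f : ι → ℚ) (k : ℤ) (hk : k ≤ 0)
    (h : ∀ i ∈ s, k ≤ padicValRat p (f i)) : k ≤ padicValRat p (∑ i ∈ s, f i) := by
  classical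
  revert h
  refine Finset.induction_on s ?_ ?_
  · intro _; simp [hk]
  · intro a s ha ih h
    rw [Finset.sum_insert ha]
    by_cases hz : f a + ∑ i ∈ s, f i = 0
    · rw [hz]; simp [hk]
    · have h1 : k ≤ padicValRat p (f a) := h a (Finset.mem_insert_self a s)
      have h2 : k ≤ padicValRat p (∑ i ∈ s, f i) := ih (fun i hi => h i (Finset.mem_insert_of_mem hi))
      exact le_trans (le_min h1 h2) (padicValRat.min_le_padicValRat_add hz)

/-- An odd prime does not divide `4`. -/
theorem padicValNat_four_eq_zero {p : ℕ} [hp : Fact p.Prime] (hp2 : p ≠ 2) : padicValNat p 4 = 0 := by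
  apply padicValNat.eq_zero_of_not_dvd
  intro h
  have h4 : (4 : ℕ) = 2 ^ 2 := by norm_num
  rw [h4] at h
  exact hp2 ((Nat.prime_dvd_prime_iff_eq hp.out Nat.prime_two).mp (hp.out.dvd_of_dvd_pow h))

/-- `v_p(2) = 0` for an odd prime `p`. -/
theorem padicValNat_two_eq_zero {p : ℕ} [hp : Fact p.Prime] (hp2 : p ≠ 2) : padicValNat p 2 = 0 := by
  apply padicValNat.eq_zero_of_not_dvd
  intro h
  exact hp2 ((Nat.prime_dvd_prime_iff_eq hp.out Nat.prime_two).mp h)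

/-- `v_p(4^i) = 0` for an odd prime `p`. -/
theorem padicValNat_four_pow_eq_zero {p : ℕ} [Fact p.Prime] (hp2 : p ≠ 2) (i : ℕ) : padicValNat p (4 ^ i) = 0 := by
  rw [padicValNat.pow 4 i, padicValNat_four_eq_zero hp2, mul_zero]

/-- `v_p(n) ≤ ⌊log_p n⌋`, in `ℤ`. -/
theorem padicValNat_le_log_int (p n : ℕ) [Fact p.Prime] : ((padicValNat p n : ℕ) : ℤ) ≤ (Nat.log p n : ℤ) := by
  exact_mod_cast padicValNat_le_nat_log n

/-! ### The Kummer-type inequality for the central binomial coefficient at an odd square -/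

/-- `(2μ+1)·C(2μ,μ) = (μ+1)·C(2μ+1,μ)`. -/
theorem succ_mul_centralBinom (μ : ℕ) : (2 * μ + 1) * Nat.choose (2 * μ) μ = (μ + 1) * Nat.choose (2 * μ + 1) μ := by
  have h := Nat.choose_mul_succ_eq (2 * μ) μ
  -- h : (2μ).choose μ * (2μ + 1) = (2μ+1).choose μ * (2μ + 1 - μ)
  have e : 2 * μ + 1 - μ = μ + 1 := by omega
  rw [e] at h
  calc (2 * μ + 1) * Nat.choose (2 * μ) μ = Nat.choose (2 * μ) μ * (2 * μ + 1) := by ring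
    _ = Nat.choose (2 * μ + 1) μ * (μ + 1) := h
    _ = (μ + 1) * Nat.choose (2 * μ + 1) μ := by ring

/-- **Kummer-type bound.** For every prime `p`: `2·v_p(2μ+1) + v_p(C(2μ,μ)) ≤ 2·⌊log_p(2μ+1)⌋`
(used for odd `p`; for `p = 2` the first summand vanishes). -/
theorem choose_central_odd_sq {p : ℕ} [hp : Fact p.Prime] (μ : ℕ) :
    2 * padicValNat p (2 * μ + 1) + padicValNat p (Nat.choose (2 * μ) μ) ≤ 2 * Nat.log p (2 * μ + 1) := by
  have hC : Nat.choose (2 * μ) μ ≠ 0 := (Nat.choose_pos (by omega)).ne'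
  have hC1 : Nat.choose (2 * μ + 1) μ ≠ 0 := (Nat.choose_pos (by omega)).ne'
  have hlogC : padicValNat p (Nat.choose (2 * μ) μ) ≤ Nat.log p (2 * μ) := by
    rw [← Nat.factorization_def _ hp.out]; exact Nat.factorization_choose_le_log
  have hlogC1 : padicValNat p (Nat.choose (2 * μ + 1) μ) ≤ Nat.log p (2 * μ + 1) := by
    rw [← Nat.factorization_def _ hp.out]; exact Nat.factorization_choose_le_log
  have hv1 : padicValNat p (2 * μ + 1) ≤ Nat.log p (2 * μ + 1) := padicValNat_le_nat_log _
  have hmono : Nat.log p (2 * μ) ≤ Nat.log p (2 * μ + 1) := Nat.log_mono_right (by omega)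
  by_cases hd : p ∣ 2 * μ + 1
  · -- then p ∤ μ+1, and (2μ+1) C(2μ,μ) = (μ+1) C(2μ+1,μ)
    have hnd : ¬ p ∣ μ + 1 := by
      intro h2
      have h3 : p ∣ 2 * (μ + 1) := dvd_mul_of_dvd_right h2 2
      have e : 2 * (μ + 1) = (2 * μ + 1) + 1 := by ring
      rw [e] at h3
      have h4 : p ∣ 1 := (Nat.dvd_add_right hd).mp h3
      exact hp.out.one_lt.ne' (Nat.dvd_one.mp h4)
    have hprod : padicValNat p ((2 * μ + 1) * Nat.choose (2 * μ) μ)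
        = padicValNat p (2 * μ + 1) + padicValNat p (Nat.choose (2 * μ) μ) :=
      padicValNat.mul (by omega) hC
    have hprod' : padicValNat p ((μ + 1) * Nat.choose (2 * μ + 1) μ)
        = padicValNat p (μ + 1) + padicValNat p (Nat.choose (2 * μ + 1) μ) :=
      padicValNat.mul (by omega) hC1
    have h0 : padicValNat p (μ + 1) = 0 := padicValNat.eq_zero_of_not_dvd hnd
    have key : padicValNat p (2 * μ + 1) + padicValNat p (Nat.choose (2 * μ) μ)
        = padicValNat p (Nat.choose (2 * μ + 1) μ) := by
      rw [← hprod, succ_mul_centralBinom, hprod', h0, zero_add]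
    omega
  · have h0 : padicValNat p (2 * μ + 1) = 0 := padicValNat.eq_zero_of_not_dvd hd
    omega

/-! ### The atom lemmas -/

/-- Valuation of one `σ`-term: `v_p(C(2i,i)/(4^i(2i+1))) ≥ −⌊log_p(2i+1)⌋` (odd `p`). -/
theorem sigmaTerm_padicValRat_ge {p : ℕ} [hp : Fact p.Prime] (hp2 : p ≠ 2) (i : ℕ) :
    -(Nat.log p (2 * i + 1) : ℤ) ≤ padicValRat p ((Nat.choose (2 * i) i : ℚ) / ((4 ^ i * (2 * i + 1) : ℕ) : ℚ)) := by
  have hC : Nat.choose (2 * i) i ≠ 0 := (Nat.choose_pos (by omega)).ne'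
  have hD : (4 ^ i * (2 * i + 1) : ℕ) ≠ 0 := by positivity
  have hCq : (Nat.choose (2 * i) i : ℚ) ≠ 0 := by exact_mod_cast hC
  have hDq : ((4 ^ i * (2 * i + 1) : ℕ) : ℚ) ≠ 0 := by exact_mod_cast hD
  rw [padicValRat.div hCq hDq, padicValRat.of_nat, padicValRat.of_nat,
    padicValNat.mul (by positivity) (by omega), padicValNat_four_pow_eq_zero hp2, zero_add]
  have h1 := padicValNat_le_log_int p (2 * i + 1)
  have h2 : (0 : ℤ) ≤ ((padicValNat p (Nat.choose (2 * i) i) : ℕ) : ℤ) := by positivity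
  linarith

/-- **Atom lemma (σ)** (`CATK6.md` §3, `CATK1.md` L5): for an odd prime `p`, `v_p(σ(a)) ≥ −⌊log_p(2a−1)⌋`. -/
theorem sigmaAtom_padicValRat_ge {p : ℕ} [hp : Fact p.Prime] (hp2 : p ≠ 2) (a : ℕ) :
    -(Nat.log p (2 * a - 1) : ℤ) ≤ padicValRat p (sigmaAtom a) := by
  unfold sigmaAtom
  apply le_padicValRat_sum _ _ _ (by
    have : (0 : ℤ) ≤ (Nat.log p (2 * a - 1) : ℤ) := by positivity
    linarith)
  intro i hi
  rw [Finset.mem_range] at hi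
  have hmono : Nat.log p (2 * i + 1) ≤ Nat.log p (2 * a - 1) := Nat.log_mono_right (by omega)
  have hmono' : (Nat.log p (2 * i + 1) : ℤ) ≤ (Nat.log p (2 * a - 1) : ℤ) := by exact_mod_cast hmono
  have h := sigmaTerm_padicValRat_ge hp2 i
  linarith

/-- Valuation of one `gsum`-term: `v_p(4^μ/(2(2μ+1)²C(2μ,μ))) ≥ −2⌊log_p(2μ+1)⌋` (odd `p`). -/
theorem gsumTerm_padicValRat_ge {p : ℕ} [hp : Fact p.Prime] (hp2 : p ≠ 2) (μ : ℕ) :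
    -(2 * (Nat.log p (2 * μ + 1) : ℤ))
      ≤ padicValRat p (((4 ^ μ : ℕ) : ℚ) / ((2 * (2 * μ + 1) ^ 2 * Nat.choose (2 * μ) μ : ℕ) : ℚ)) := by
  have hC : Nat.choose (2 * μ) μ ≠ 0 := (Nat.choose_pos (by omega)).ne'
  have hN : (4 ^ μ : ℕ) ≠ 0 := by positivity
  have hD : (2 * (2 * μ + 1) ^ 2 * Nat.choose (2 * μ) μ : ℕ) ≠ 0 := by positivity
  have hNq : ((4 ^ μ : ℕ) : ℚ) ≠ 0 := by exact_mod_cast hN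
  have hDq : ((2 * (2 * μ + 1) ^ 2 * Nat.choose (2 * μ) μ : ℕ) : ℚ) ≠ 0 := by exact_mod_cast hD
  rw [padicValRat.div hNq hDq, padicValRat.of_nat, padicValRat.of_nat, padicValNat_four_pow_eq_zero hp2,
    padicValNat.mul (by positivity) hC, padicValNat.mul (by norm_num) (by positivity), padicValNat_two_eq_zero hp2,
    padicValNat.pow (2 * μ + 1) 2, zero_add]
  have hk := choose_central_odd_sq (p := p) μ
  have hk' : ((2 * padicValNat p (2 * μ + 1) + padicValNat p (Nat.choose (2 * μ) μ) : ℕ) : ℤ)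
      ≤ ((2 * Nat.log p (2 * μ + 1) : ℕ) : ℤ) := by exact_mod_cast hk
  push_cast at hk' ⊢
  linarith

/-- **Atom lemma (gsum)** (`CATK6.md` §3, `CATK1.md` L6): for an odd prime `p`, `v_p(gsum(c)) ≥ −2⌊log_p(2c−1)⌋`. -/
theorem gsumAtom_padicValRat_ge {p : ℕ} [hp : Fact p.Prime] (hp2 : p ≠ 2) (c : ℕ) :
    -(2 * (Nat.log p (2 * c - 1) : ℤ)) ≤ padicValRat p (gsumAtom c) := by
  unfold gsumAtom
  apply le_padicValRat_sum _ _ _ (by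
    have : (0 : ℤ) ≤ (Nat.log p (2 * c - 1) : ℤ) := by positivity
    linarith)
  intro μ hμ
  rw [Finset.mem_range] at hμ
  have hmono : Nat.log p (2 * μ + 1) ≤ Nat.log p (2 * c - 1) := Nat.log_mono_right (by omega)
  have hmono' : (Nat.log p (2 * μ + 1) : ℤ) ≤ (Nat.log p (2 * c - 1) : ℤ) := by exact_mod_cast hmono
  have h := gsumTerm_padicValRat_ge hp2 μ
  linarith

/-- The two atom lemmas in the `d*`-form of `CATK6.md` §3: `v_p ≥ −(cost)·T_{2a−1}(p)` with costs `1` (σ) and `2` (gsum),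
packaged for the per-level bookkeeping of Theorem K6. -/
theorem atom_costs {p : ℕ} [Fact p.Prime] (hp2 : p ≠ 2) (a c : ℕ) :
    -((1 : ℤ) * Nat.log p (2 * a - 1)) ≤ padicValRat p (sigmaAtom a)
      ∧ -((2 : ℤ) * Nat.log p (2 * c - 1)) ≤ padicValRat p (gsumAtom c) := by
  refine ⟨?_, gsumAtom_padicValRat_ge hp2 c⟩
  have := sigmaAtom_padicValRat_ge hp2 a
  linarith

/-! ### The atom `W(a)` (CATK1 Lemma S (S-iv), L7)

`S₂(a) = Σ_ν t_ν/(ν+½+a)² = t_{a−1}(W(a) − 8G)` with `W(1) = 8`,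
`W(a) = W(a−1) + 8C(2b,b)/(4^b(2b+1)²) − 2σ(b)/(b(2b+1))`, `b = a−1`.  We take the unrolled recursion as the
definition (the `b = 0` summand is the initial value `8`; `W(0) = 0` is a harmless junk value). -/

/-- increment₁(b) = `8C(2b,b)/(4^b(2b+1)²)`. -/
def wInc₁ (b : ℕ) : ℚ := ((8 * Nat.choose (2 * b) b : ℕ) : ℚ) / ((4 ^ b * (2 * b + 1) ^ 2 : ℕ) : ℚ)

/-- increment₂(b) = `2σ(b)/(b(2b+1))`. -/
def wInc₂ (b : ℕ) : ℚ := 2 * sigmaAtom b / ((b * (2 * b + 1) : ℕ) : ℚ)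

/-- the `b`-th summand of `W`: `8` for `b = 0`, else `increment₁(b) − increment₂(b)`. -/
def wTerm (b : ℕ) : ℚ := if b = 0 then 8 else wInc₁ b - wInc₂ b

/-- `W(a) = 8 + Σ_{1≤b<a} (8C(2b,b)/(4^b(2b+1)²) − 2σ(b)/(b(2b+1)))` (`a ≥ 1`). -/
def Watom (a : ℕ) : ℚ := ∑ b ∈ range a, wTerm b

/-- Sanity values: `W(1) = 8`, `W(2) = 70/9`, `W(3) = 3449/450`. -/
theorem Watom_small : Watom 1 = 8 ∧ Watom 2 = 70 / 9 ∧ Watom 3 = 3449 / 450 := by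
  refine ⟨?_, ?_, ?_⟩ <;>
    norm_num [Watom, wTerm, wInc₁, wInc₂, sigmaAtom, Finset.sum_range_succ, Nat.choose_succ_succ]

/-- The recursion (S-iv) holds by construction. -/
theorem Watom_succ (a : ℕ) (ha : 1 ≤ a) : Watom (a + 1) = Watom a + wInc₁ a - wInc₂ a := by
  unfold Watom
  rw [Finset.sum_range_succ]
  have : wTerm a = wInc₁ a - wInc₂ a := by unfold wTerm; rw [if_neg (by omega)]
  rw [this]; ring

/-- `σ(b) > 0` for `b ≥ 1`. -/
theorem sigmaAtom_pos (b : ℕ) (hb : 1 ≤ b) : 0 < sigmaAtom b := by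
  unfold sigmaAtom
  apply Finset.sum_pos
  · intro i _
    have hC : 0 < Nat.choose (2 * i) i := Nat.choose_pos (by omega)
    positivity
  · exact ⟨0, Finset.mem_range.mpr (by omega)⟩

/-- `v_p(8) = 0` for an odd prime `p`. -/
theorem padicValNat_eight_eq_zero {p : ℕ} [Fact p.Prime] (hp2 : p ≠ 2) : padicValNat p 8 = 0 := by
  rw [show (8 : ℕ) = 2 ^ 3 by norm_num, padicValNat.pow 2 3, padicValNat_two_eq_zero hp2, mul_zero]

/-- `v_p(wInc₁ b) ≥ −2·log_p(2b+1)` for an odd prime `p`. -/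
theorem wInc₁_padicValRat_ge {p : ℕ} [hp : Fact p.Prime] (hp2 : p ≠ 2) (b : ℕ) :
    -(2 * (Nat.log p (2 * b + 1) : ℤ)) ≤ padicValRat p (wInc₁ b) := by
  unfold wInc₁
  have hC : Nat.choose (2 * b) b ≠ 0 := (Nat.choose_pos (by omega)).ne'
  have hN : (8 * Nat.choose (2 * b) b : ℕ) ≠ 0 := by positivity
  have hD : (4 ^ b * (2 * b + 1) ^ 2 : ℕ) ≠ 0 := by positivity
  have hNq : ((8 * Nat.choose (2 * b) b : ℕ) : ℚ) ≠ 0 := by exact_mod_cast hN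
  have hDq : ((4 ^ b * (2 * b + 1) ^ 2 : ℕ) : ℚ) ≠ 0 := by exact_mod_cast hD
  rw [padicValRat.div hNq hDq, padicValRat.of_nat, padicValRat.of_nat, padicValNat.mul (by norm_num) hC,
    padicValNat_eight_eq_zero hp2, padicValNat.mul (by positivity) (by positivity), padicValNat_four_pow_eq_zero hp2,
    padicValNat.pow (2 * b + 1) 2]
  have h1 := padicValNat_le_log_int p (2 * b + 1)
  have h2 : (0 : ℤ) ≤ ((padicValNat p (Nat.choose (2 * b) b) : ℕ) : ℤ) := by positivity
  push_cast at h1 h2 ⊢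
  linarith

/-- `v_p(b) + v_p(2b+1) ≤ ⌊log_p(2b−1)⌋ + ⌊log_p(2b+1)⌋`… in the usable form: `v_p(b) + v_p(2b+1) + ⌊log_p(2b−1)⌋ ≤ 2⌊log_p(2b+1)⌋`
(`gcd(b,2b+1) = 1`, so one of the two valuations vanishes; `v_p(b) ≤ ⌊log_p b⌋ ≤ ⌊log_p(2b+1)⌋`). -/
theorem coprime_budget {p : ℕ} [hp : Fact p.Prime] (b : ℕ) (hb : 1 ≤ b) :
    padicValNat p b + padicValNat p (2 * b + 1) + Nat.log p (2 * b - 1) ≤ 2 * Nat.log p (2 * b + 1) := by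
  have hvb : padicValNat p b ≤ Nat.log p b := padicValNat_le_nat_log _
  have hv1 : padicValNat p (2 * b + 1) ≤ Nat.log p (2 * b + 1) := padicValNat_le_nat_log _
  have hm1 : Nat.log p b ≤ Nat.log p (2 * b + 1) := Nat.log_mono_right (by omega)
  have hm2 : Nat.log p (2 * b - 1) ≤ Nat.log p (2 * b + 1) := Nat.log_mono_right (by omega)
  by_cases hd : p ∣ 2 * b + 1
  · have hnd : ¬ p ∣ b := by
      intro h2
      have h3 : p ∣ 2 * b := dvd_mul_of_dvd_right h2 2
      have h4 : p ∣ 1 := (Nat.dvd_add_right h3).mp hd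
      exact hp.out.one_lt.ne' (Nat.dvd_one.mp h4)
    have h0 : padicValNat p b = 0 := padicValNat.eq_zero_of_not_dvd hnd
    omega
  · have h0 : padicValNat p (2 * b + 1) = 0 := padicValNat.eq_zero_of_not_dvd hd
    omega

/-- `v_p(wInc₂ b) ≥ −2·log_p(2b+1)` for an odd prime `p` and `b ≥ 1`. -/
theorem wInc₂_padicValRat_ge {p : ℕ} [hp : Fact p.Prime] (hp2 : p ≠ 2) (b : ℕ) (hb : 1 ≤ b) :
    -(2 * (Nat.log p (2 * b + 1) : ℤ)) ≤ padicValRat p (wInc₂ b) := by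
  unfold wInc₂
  have hσ : sigmaAtom b ≠ 0 := (sigmaAtom_pos b hb).ne'
  have hD : (b * (2 * b + 1) : ℕ) ≠ 0 := by positivity
  have hDq : ((b * (2 * b + 1) : ℕ) : ℚ) ≠ 0 := by exact_mod_cast hD
  have h2q : (2 : ℚ) ≠ 0 := by norm_num
  rw [padicValRat.div (mul_ne_zero h2q hσ) hDq, padicValRat.mul h2q hσ, padicValRat.of_nat,
    padicValNat.mul (by omega) (by omega)]
  have hv2 : padicValRat p (2 : ℚ) = 0 := by
    rw [show (2 : ℚ) = ((2 : ℕ) : ℚ) by norm_num, padicValRat.of_nat, padicValNat_two_eq_zero hp2]; simp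
  rw [hv2, zero_add]
  have hs := sigmaAtom_padicValRat_ge hp2 b
  have hc := coprime_budget (p := p) b hb
  have hc' : ((padicValNat p b + padicValNat p (2 * b + 1) + Nat.log p (2 * b - 1) : ℕ) : ℤ)
      ≤ ((2 * Nat.log p (2 * b + 1) : ℕ) : ℤ) := by exact_mod_cast hc
  push_cast at hc' ⊢
  linarith

/-- `v_p(wTerm b) ≥ −2·log_p(2b+1)` for an odd prime `p`. -/
theorem wTerm_padicValRat_ge {p : ℕ} [hp : Fact p.Prime] (hp2 : p ≠ 2) (b : ℕ) :
    -(2 * (Nat.log p (2 * b + 1) : ℤ)) ≤ padicValRat p (wTerm b) := by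
  unfold wTerm
  by_cases hb : b = 0
  · rw [if_pos hb]
    rw [show (8 : ℚ) = ((8 : ℕ) : ℚ) by norm_num, padicValRat.of_nat, padicValNat_eight_eq_zero hp2]
    have : (0 : ℤ) ≤ (Nat.log p (2 * b + 1) : ℤ) := by positivity
    push_cast; linarith
  · rw [if_neg hb]
    have hb1 : 1 ≤ b := Nat.one_le_iff_ne_zero.mpr hb
    have h1 := wInc₁_padicValRat_ge hp2 b
    have h2 := wInc₂_padicValRat_ge hp2 b hb1
    by_cases hz : wInc₁ b - wInc₂ b = 0
    · rw [hz, padicValRat.zero]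
      have : (0 : ℤ) ≤ (Nat.log p (2 * b + 1) : ℤ) := by positivity
      linarith
    · rw [sub_eq_add_neg] at hz ⊢
      have h2' : -(2 * (Nat.log p (2 * b + 1) : ℤ)) ≤ padicValRat p (-wInc₂ b) := by rwa [padicValRat.neg]
      exact le_trans (le_min h1 h2') (padicValRat.min_le_padicValRat_add hz)

/-- **Atom lemma (W)** (`CATK1.md` L7, `CATK6.md` §3): for an odd prime `p`, `v_p(W(a)) ≥ −2⌊log_p(2a−1)⌋`. -/
theorem Watom_padicValRat_ge {p : ℕ} [hp : Fact p.Prime] (hp2 : p ≠ 2) (a : ℕ) :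
    -(2 * (Nat.log p (2 * a - 1) : ℤ)) ≤ padicValRat p (Watom a) := by
  unfold Watom
  apply le_padicValRat_sum _ _ _ (by
    have : (0 : ℤ) ≤ (Nat.log p (2 * a - 1) : ℤ) := by positivity
    linarith)
  intro b hb
  rw [Finset.mem_range] at hb
  have hmono : Nat.log p (2 * b + 1) ≤ Nat.log p (2 * a - 1) := Nat.log_mono_right (by omega)
  have hmono' : (Nat.log p (2 * b + 1) : ℤ) ≤ (Nat.log p (2 * a - 1) : ℤ) := by exact_mod_cast hmono
  have h := wTerm_padicValRat_ge hp2 b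
  linarith

/-- The three universal atom lemmas in the `d*`-cost form of `CATK6.md` §3 (costs `1, 2, 2` per level `q ≤ 2a−1`). -/
theorem atom_costs' {p : ℕ} [Fact p.Prime] (hp2 : p ≠ 2) (a : ℕ) :
    -((1 : ℤ) * Nat.log p (2 * a - 1)) ≤ padicValRat p (sigmaAtom a)
      ∧ -((2 : ℤ) * Nat.log p (2 * a - 1)) ≤ padicValRat p (gsumAtom a)
      ∧ -((2 : ℤ) * Nat.log p (2 * a - 1)) ≤ padicValRat p (Watom a) := by
  refine ⟨?_, gsumAtom_padicValRat_ge hp2 a, Watom_padicValRat_ge hp2 a⟩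
  have := sigmaAtom_padicValRat_ge hp2 a
  linarith

end Summit.KontsevichZagierPeriods.Zeta5Search.Denom.CatalanRayAtoms
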